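import Summits.BirchSwinnertonDyer.Rank1Residual.Additive.ShaGrowthDichotomyThree
import Summits.BirchSwinnertonDyer.Rank1Residual.Additive.LocIrrValuationCriterionThreeProofs
import Literature.NumberTheory.EllipticCurves.LocalKummerIsotropyTransport
import Literature.NumberTheory.EllipticCurves.PointCountHasseInvariantProofs
import HarnessLib

/-!
# T-O6-D′ (iii) PROVED: `CompanionTypeIffLocIrrThree` — a companion `A` of `W` at `3` (good at `3`,
# `A[3] ≅ W[3]` as `Gal(ℚ̄/ℚ)`-modules) is SUPERSINGULAR at `3` iff `W[3]|G_{ℚ₃}` is irreducible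
# (cell `b2b-bsdres`, lane CLASS-CLOSURE / class O6; cross-cell pool work of seat `b2b-bsdres-x11b3-p4`
# GEN 10 under the x11b3 lead's P-POOL rule R12-38 (b), ruling R12-48; first refusals: o6-r1 / o6-r2 /
# cc-typer-5; THEOREMS ONLY)

HONEST FRAMING (cell `b2b-bsdres`, run/shared/lean/b2b/bsd-rank1-residual/, verbatim in every
file): the goal of the cell is to DELETE the COMBINATION-SHAPED residual classes of the
Birch–Swinnerton-Dyer formula for ALL analytic-rank `≤ 1` elliptic curves over `ℚ` — "full BSD
formula for every rank `≤ 1` curve in class `C`" assembled STRICTLY from published theorems — so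
that the rank-`≤ 1` remainder becomes exactly the CONSTRUCTION-SHAPED classes, which are TYPED
(missing-input `Prop`s), NOT attempted. This is not "finishing BSD". This file: THEOREMS ONLY (no
definition, no named fact, no `sorry`, no `@[conjecture]` node); nothing about any particular curve
is asserted; nothing is booked; no mark of `RESIDUAL-MAP.md` moves; O6 stays OPEN.

## What is proved

o6-r1 GEN 4's / cc-typer-5 GEN 3's typed THEOREM-CANDIDATE
`Summit.BirchSwinnertonDyer.Rank1Residual.Additive.CompanionTypeIffLocIrrThree`
(`Additive/ShaGrowthDichotomyThree.lean` §3 (iii), p259222: "if `A` is a companion of `W` then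
`W[3]|G_{ℚ₃}` is irreducible iff `A` is SUPERSINGULAR at `3` (`3 ∣ a₃(A)`)" — Serre, Invent. Math.
15 (1972) §1.11) is a tree theorem:

* `companionTypeIffLocIrrThree_holds : CompanionTypeIffLocIrrThree` (binders verbatim: all
  `W A / ℚ` elliptic and globally minimal with `IsCompanionThree W A`; no `LocIrr`, O6, conductor
  or rank hypothesis),

assembled from two lemmas of independent use:

* `locIrr_iff_of_equivariant` — **`LocIrr` is a function of the `Gal(ℚ̄/ℚ)`-module `E[p]`**: a
  `Γ_ℚ`-equivariant `e : A[p](ℚ̄) ≃+ W[p](ℚ̄)` gives `LocIrr W p ↔ LocIrr A p` (any prime `p`);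
* `locIrr_three_iff_dvd_frobeniusTrace_of_hasGoodReductionAtPrime` — **at a prime of GOOD
  reduction `3`, `E[3]|G_{ℚ₃}` is irreducible iff `3 ∣ a₃(E)`** (supersingular ⟺ locally
  irreducible, ordinary ⟺ locally reducible), for every globally minimal elliptic `A / ℚ`; one-sided
  forms `locIrr_three_of_dvd_frobeniusTrace`, `not_locIrr_three_of_not_dvd_frobeniusTrace`.

WHAT IS NOT CLAIMED: `CompanionLambdaShiftThree`, `ShaGrowthDichotomyThree`,
`ShaGrowthRateDichotomyThree` (EVIDENCE conjecture nodes of the same file family) are untouched; the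
census behind the law (cc-eng-3 A-ENG3-3 PART A/B: 1 639 + 8 | 168 partnered rows, 0 exceptions;
cc-eng-1 `locirr3` column 2 898 / 9 127) stays EVIDENCE; the node's doc-only TARGET ↦ THEOREM restamp
is the typer's pen (cc-typer-5); nothing booked; O6 OPEN; no mark.

## Proof

(S1) TRANSPORT. The tree's `WeierstrassCurve.torsionTransferEquiv (E := ℚ_[p])`
(`Literature/…/LocalKummerIsotropyTransport.lean`) identifies `E[p](ℚ̄)` with `(E⁄ℚ_p)[p](ℚ̄_p)`
equivariantly along the restriction `absGaloisRestrict ℚ ℚ_[p] : Γ_{ℚ_p} → Γ_ℚ`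
(`torsionTransferEquiv_smul`, `torsionTransferEquiv_symm_smul`); composing the two transfers with
`e` gives a `Γ_{ℚ_p}`-equivariant `(A⁄ℚ_p)[p] ≃+ (W⁄ℚ_p)[p]`, and irreducibility
(`HasIrreducibleModPGaloisRep`, the body of `LocIrr`) is invariant under an equivariant additive
isomorphism (`hasIrreducibleModPGaloisRep_iff_of_equivariant`: the preimage of a stable subgroup is
stable).

(S2) GOOD REDUCTION AT `3`, no further Galois theory. By L-O56-sel
(`locIrrThreeIffCriterion_holds`, harvest-2 E89, `Additive/LocIrrValuationCriterionThreeProofs.lean`)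
`LocIrr A 3 ↔ c₄ ≠ 0 ∧ (c₆ = 0 ∨ 3·v₃(c₄) + 2 ≤ 2·v₃(c₆))`. On the integral model `I` of `A`
(`integralModelInt`; `3 ∤ Δ(I) = Δ_min` by `not_dvd_minimalDiscriminantInt_of_hasGoodReductionAtPrime`):
Silverman *AEC* V.4.1(a) in the tree (`WeierstrassCurve.cast_card_add_one_sub_natCard_point`,
`PointCountHasseInvariantProofs.lean`) on the reduction `I ⊗ 𝔽₃` (elliptic as `3 ∤ Δ`) reads, at
`q = 3`, `a₃(A) = coeff_{x²}(Ψ₂²) = b₂` in `𝔽₃` (`three_dvd_frobeniusTrace_iff_three_dvd_b₂`); and the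
INTEGER LEMMA `three_dvd_b₂_iff_criterion` for any `I / ℤ` with `3 ∤ Δ` (`c₄ = b₂² − 24b₄`,
`c₆ = −b₂³ + 36b₂b₄ − 216b₆`, `1728Δ = c₄³ − c₆²`): `3 ∣ b₂ ⟹ 3 ∣ c₄`, `27 ∣ c₆`, `c₄ ≠ 0` and
`9 ∤ c₄` (else `3⁶ ∣ 1728Δ`), so the criterion holds (`5 ≤ 6`); `3 ∤ b₂ ⟹ v₃(c₄) = 0` and the
criterion would give `3 ∣ c₆`, whence `3 ∣ c₄³ = 1728Δ + c₆²` — contradiction.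

References: J.-P. Serre, *Propriétés galoisiennes des points d'ordre fini des courbes elliptiques*,
Invent. Math. 15 (1972), §1.11 Prop. 11–12 [Serre1972]; J. H. Silverman, *The Arithmetic of
Elliptic Curves*, 2nd ed. (2009), V.4.1(a), VII.5.1 [SilvermanAEC2009]; cell:
`cells/o5o6/TARGETS.md` §O6 (G4-3) / (G5-7), `class-closure/O6/TYPED.md` §8, INBOX INTENT
2026-08-21T20:59Z (x11b3-p4 GEN 10), x11b3-lead R12-38 (b).

## Design

No definitions; `noncomputable section`; `open scoped Classical`. The transport lemma is stated
for any prime `p` and any two elliptic curves over `ℚ`; the good-reduction lemma for any globally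
minimal elliptic `A / ℚ`. Axioms: `propext`, `Classical.choice`, `Quot.sound`.
-/

set_option autoImplicit false

noncomputable section

open scoped Classical

open WeierstrassCurve Literature.NumberTheory.EllipticCurves
  Literature.NumberTheory.EllipticCurves.Rank1Residual
  Literature.NumberTheory.EllipticCurves.Rank1Residual.Typed
  Literature.NumberTheory.GaloisRepresentations Field

namespace Summit.BirchSwinnertonDyer.Rank1Residual.Additive

/-! ## §1 Irreducibility of `E[p]` is invariant under equivariant isomorphisms -/

section Transport

variable {F : Type*} [Field F] {V V' : WeierstrassCurve F} {p : ℕ}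

/-- **Irreducibility passes along an equivariant additive isomorphism** (one direction): if
`f : V[p] ≃+ V'[p]` commutes with `Γ_F` and `V[p]` is an irreducible `Γ_F`-module, so is `V'[p]`
(the preimage `f⁻¹(H)` of a stable subgroup `H ≤ V'[p]` is stable). [folklore] -/
theorem hasIrreducibleModPGaloisRep_of_equivariant
    (f : geomTorsion V (p : ℤ) ≃+ geomTorsion V' (p : ℤ))
    (hf : ∀ (σ : absoluteGaloisGroup F) (P : geomTorsion V (p : ℤ)), f (σ • P) = σ • f P)
    (h : V.HasIrreducibleModPGaloisRep p) : V'.HasIrreducibleModPGaloisRep p := by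
  intro H hH
  have hstab : ∀ (σ : absoluteGaloisGroup F), ∀ P ∈ H.comap f.toAddMonoidHom,
      σ • P ∈ H.comap f.toAddMonoidHom := fun σ P hP ↦ by
    rw [AddSubgroup.mem_comap] at hP ⊢
    change f (σ • P) ∈ H
    rw [hf]
    exact hH σ _ hP
  rcases h (H.comap f.toAddMonoidHom) hstab with hbot | htop
  · left
    rw [eq_bot_iff]
    intro Q hQ
    have hQ' : f.symm Q ∈ H.comap f.toAddMonoidHom := by
      rw [AddSubgroup.mem_comap]
      change f (f.symm Q) ∈ H
      rwa [AddEquiv.apply_symm_apply]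
    rw [hbot, AddSubgroup.mem_bot] at hQ'
    rw [AddSubgroup.mem_bot, ← f.apply_symm_apply Q, hQ', map_zero]
  · right
    rw [eq_top_iff]
    intro Q _
    have hQ' : f.symm Q ∈ H.comap f.toAddMonoidHom := by rw [htop]; exact AddSubgroup.mem_top _
    rw [AddSubgroup.mem_comap] at hQ'
    change f (f.symm Q) ∈ H at hQ'
    rwa [AddEquiv.apply_symm_apply] at hQ'

/-- An equivariant additive isomorphism has an equivariant inverse. [folklore] -/
theorem addEquiv_symm_smul_of_equivariant
    (f : geomTorsion V (p : ℤ) ≃+ geomTorsion V' (p : ℤ))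
    (hf : ∀ (σ : absoluteGaloisGroup F) (P : geomTorsion V (p : ℤ)), f (σ • P) = σ • f P)
    (σ : absoluteGaloisGroup F) (Q : geomTorsion V' (p : ℤ)) :
    f.symm (σ • Q) = σ • f.symm Q := by
  apply f.injective
  rw [AddEquiv.apply_symm_apply, hf, AddEquiv.apply_symm_apply]

/-- **Irreducibility is invariant under an equivariant additive isomorphism `V[p] ≃+ V'[p]`.**
[folklore] -/
theorem hasIrreducibleModPGaloisRep_iff_of_equivariant
    (f : geomTorsion V (p : ℤ) ≃+ geomTorsion V' (p : ℤ))
    (hf : ∀ (σ : absoluteGaloisGroup F) (P : geomTorsion V (p : ℤ)), f (σ • P) = σ • f P) :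
    V.HasIrreducibleModPGaloisRep p ↔ V'.HasIrreducibleModPGaloisRep p :=
  ⟨hasIrreducibleModPGaloisRep_of_equivariant f hf,
    hasIrreducibleModPGaloisRep_of_equivariant f.symm (addEquiv_symm_smul_of_equivariant f hf)⟩

end Transport

/-! ## §2 `LocIrr` is a function of the global Galois module `E[p](ℚ̄)` -/

section LocIrrTransport

variable (W A : WeierstrassCurve ℚ) [W.IsElliptic] [A.IsElliptic] (p : ℕ) [Fact p.Prime]

/-- **`LocIrr` depends only on the `Gal(ℚ̄/ℚ)`-module `E[p]`**: a `Γ_ℚ`-equivariant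
`e : A[p](ℚ̄) ≃+ W[p](ℚ̄)` gives `LocIrr W p ↔ LocIrr A p` (`E[p]|G_{ℚ_p}` irreducible for `W` iff
for `A`). The two torsion transfers `E[p](ℚ̄) ≃+ (E⁄ℚ_p)[p](ℚ̄_p)` of the tree
(`torsionTransferEquiv`, equivariant along `absGaloisRestrict ℚ ℚ_[p] : Γ_{ℚ_p} → Γ_ℚ`) conjugate
`e` into a `Γ_{ℚ_p}`-equivariant isomorphism of the local modules. [folklore] -/
theorem locIrr_iff_of_equivariant (e : geomTorsion A (p : ℤ) ≃+ geomTorsion W (p : ℤ))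
    (he : ∀ (σ : absoluteGaloisGroup ℚ) (P : geomTorsion A (p : ℤ)), e (σ • P) = σ • e P) :
    LocIrr W p ↔ LocIrr A p := by
  have hp0 : (p : ℤ) ≠ 0 := by exact_mod_cast (Fact.out : p.Prime).ne_zero
  let tW := W.torsionTransferEquiv (E := ℚ_[p]) hp0
  let tA := A.torsionTransferEquiv (E := ℚ_[p]) hp0
  let f : geomTorsion (A.baseChange ℚ_[p]) (p : ℤ) ≃+ geomTorsion (W.baseChange ℚ_[p]) (p : ℤ) :=
    (tA.symm.trans e).trans tW
  have hf : ∀ (σ : absoluteGaloisGroup ℚ_[p]) (S : geomTorsion (A.baseChange ℚ_[p]) (p : ℤ)),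
      f (σ • S) = σ • f S := fun σ S ↦ by
    change tW (e (tA.symm (σ • S))) = σ • tW (e (tA.symm S))
    rw [A.torsionTransferEquiv_symm_smul (E := ℚ_[p]) hp0 σ S, he,
      W.torsionTransferEquiv_smul (E := ℚ_[p]) hp0 σ]
  exact (hasIrreducibleModPGaloisRep_iff_of_equivariant f hf).symm

/-- The companion relation transports `LocIrr` at `3`:
`IsCompanionThree W A → (LocIrr W 3 ↔ LocIrr A 3)`. [folklore] -/
theorem locIrr_three_iff_of_isCompanionThree (h : IsCompanionThree W A) :
    LocIrr W 3 ↔ LocIrr A 3 := by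
  obtain ⟨_, e, he⟩ := h
  exact locIrr_iff_of_equivariant W A 3 e he

end LocIrrTransport

/-! ## §3 The integer lemma: `3 ∣ b₂` iff the `c₄/c₆` criterion, when `3 ∤ Δ` -/

section IntegerLemma

/-- `3 ∣ 64·x ⟹ 3 ∣ x`. [folklore] -/
private theorem three_dvd_of_three_dvd_sixtyfour_mul {x : ℤ} (h : (3 : ℤ) ∣ 64 * x) : (3 : ℤ) ∣ x :=
  (Int.prime_three.dvd_mul.mp h).resolve_left (by norm_num)

/-- **The integer lemma.** For a Weierstrass equation `I` over `ℤ` with `3 ∤ Δ(I)`: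
`3 ∣ b₂(I)` iff `c₄ ≠ 0 ∧ (c₆ = 0 ∨ 3·v₃(c₄) + 2 ≤ 2·v₃(c₆))`. (`⟹`: `b₂ = 3k` gives
`c₄ = 3(3k² − 8b₄)`, `c₆ = 27(−k³ + 4kb₄ − 8b₆)`; `c₄ = 0` or `9 ∣ c₄` would put `3⁶ ∣ c₄³ − c₆² =
1728Δ = 27·64·Δ`, i.e. `3 ∣ Δ`; so `v₃(c₄) = 1 < 2 ≤ 3 ≤ v₃(c₆)`. `⟸`: if `3 ∤ b₂` then
`3 ∤ c₄ = b₂² − 24b₄`, `v₃(c₄) = 0`, and the criterion forces `3 ∣ c₆`, whence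
`3 ∣ 1728Δ + c₆² = c₄³` — contradiction.) [folklore] -/
theorem three_dvd_b₂_iff_criterion (I : WeierstrassCurve ℤ) (hΔ : ¬ (3 : ℤ) ∣ I.Δ) :
    (3 : ℤ) ∣ I.b₂ ↔
      I.c₄ ≠ 0 ∧ (I.c₆ = 0 ∨ 3 * padicValInt 3 I.c₄ + 2 ≤ 2 * padicValInt 3 I.c₆) := by
  have hrel : 1728 * I.Δ = I.c₄ ^ 3 - I.c₆ ^ 2 := I.c_relation
  have h3 : ((3 : ℕ) : ℤ) = 3 := rfl
  constructor
  · rintro ⟨k, hk⟩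
    have hc4 : I.c₄ = 3 * (3 * k ^ 2 - 8 * I.b₄) := by
      simp only [WeierstrassCurve.c₄, hk]; ring
    have hc6 : I.c₆ = 27 * (-k ^ 3 + 4 * k * I.b₄ - 8 * I.b₆) := by
      simp only [WeierstrassCurve.c₆, hk]; ring
    set m : ℤ := -k ^ 3 + 4 * k * I.b₄ - 8 * I.b₆ with hm
    have h4ne : I.c₄ ≠ 0 := by
      intro h0
      apply hΔ
      apply three_dvd_of_three_dvd_sixtyfour_mul
      rw [h0, hc6] at hrel
      exact ⟨-9 * m ^ 2, by linarith [hrel]⟩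
    refine ⟨h4ne, ?_⟩
    by_cases h6 : I.c₆ = 0
    · exact Or.inl h6
    · right
      have hv6 : 3 ≤ padicValInt 3 I.c₆ := by
        have hdvd : ((3 : ℕ) : ℤ) ^ 3 ∣ I.c₆ := ⟨m, by rw [hc6, h3]; ring⟩
        exact ((padicValInt_dvd_iff 3 I.c₆).mp hdvd).resolve_left h6
      have hv4 : padicValInt 3 I.c₄ < 2 := by
        by_contra hge
        rw [not_lt] at hge
        obtain ⟨a, ha⟩ : ((3 : ℕ) : ℤ) ^ 2 ∣ I.c₄ := (padicValInt_dvd_iff 2 I.c₄).mpr (Or.inr hge)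
        rw [h3] at ha
        apply hΔ
        apply three_dvd_of_three_dvd_sixtyfour_mul
        rw [ha, hc6] at hrel
        exact ⟨9 * a ^ 3 - 9 * m ^ 2, by linarith [hrel]⟩
      omega
  · rintro ⟨_, hcrit⟩
    by_contra hb2
    have h4 : ¬ (3 : ℤ) ∣ I.c₄ := by
      intro h
      apply hb2
      have hsq : (3 : ℤ) ∣ I.b₂ ^ 2 := by
        have h' : (3 : ℤ) ∣ I.c₄ + 24 * I.b₄ := h.add (Dvd.dvd.mul_right (by norm_num) _)
        have heq : I.c₄ + 24 * I.b₄ = I.b₂ ^ 2 := by simp only [WeierstrassCurve.c₄]; ring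
        rwa [heq] at h'
      exact Int.prime_three.dvd_of_dvd_pow hsq
    have hv4 : padicValInt 3 I.c₄ = 0 := padicValInt.eq_zero_of_not_dvd (by rwa [h3])
    have h6 : (3 : ℤ) ∣ I.c₆ := by
      rcases hcrit with h0 | hle
      · rw [h0]; exact dvd_zero 3
      · rw [hv4] at hle
        have hdvd : ((3 : ℕ) : ℤ) ^ 1 ∣ I.c₆ := (padicValInt_dvd_iff 1 I.c₆).mpr (Or.inr (by omega))
        rwa [h3, pow_one] at hdvd
    apply h4
    have hcube : (3 : ℤ) ∣ I.c₄ ^ 3 := by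
      have heq : I.c₄ ^ 3 = 1728 * I.Δ + I.c₆ ^ 2 := by linarith [hrel]
      rw [heq]
      exact (Dvd.dvd.mul_right (by norm_num) _).add (dvd_pow h6 two_ne_zero)
    exact Int.prime_three.dvd_of_dvd_pow hcube

end IntegerLemma

/-! ## §4 Good reduction at `3`: `a₃ ≡ b₂ (mod 3)` and `LocIrr ⟺ 3 ∣ a₃` -/

section GoodThree

variable (A : WeierstrassCurve ℚ) [A.IsGloballyMinimal]

/-- **`a₃(A) ≡ b₂ (mod 3)` at a prime of good reduction `3`** (Silverman *AEC* V.4.1(a) at `q = 3`: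
the Hasse coefficient `A₃ = coeff_{x²}((4x³ + b₂x² + 2b₄x + b₆)^{(3−1)/2}) = b₂` of the reduction of
the integral model, and `a₃ = A₃` in `𝔽₃`). Hence `3 ∣ a₃(A) ↔ 3 ∣ b₂(I)` for the integral model
`I = integralModelInt A`. [cite: SilvermanAEC2009, V.4.1(a)] -/
theorem three_dvd_frobeniusTrace_iff_three_dvd_b₂ (hΔ : ¬ (3 : ℤ) ∣ A.minimalDiscriminantInt) :
    (3 : ℤ) ∣ A.frobeniusTrace 3 ↔ (3 : ℤ) ∣ (integralModelInt A).b₂ := by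
  set I := integralModelInt A with hI
  set Ared : WeierstrassCurve (ZMod 3) := I.map (Int.castRingHom (ZMod 3)) with hAred
  haveI : Ared.IsElliptic := by
    refine ⟨isUnit_iff_ne_zero.mpr ?_⟩
    rw [hAred, map_Δ, eq_intCast, Ne, ZMod.intCast_zmod_eq_zero_iff_dvd]
    exact hΔ
  have h2 : ringChar (ZMod 3) ≠ 2 := by rw [ZMod.ringChar_zmod_n]; decide
  have key := Ared.cast_card_add_one_sub_natCard_point h2
  rw [ZMod.card, show ((3 : ℕ) - 1) / 2 = 1 from rfl, show ((3 : ℕ) - 1) = 2 from rfl, pow_one,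
    Cubic.coeff_eq_b] at key
  -- `key : (((3 : ℕ) : ℤ) + 1 - #Ared(𝔽₃) : ZMod 3) = b(Ψ₂²) = b₂(Ared)`
  have hb : Ared.twoTorsionPolynomial.b = (I.b₂ : ZMod 3) := by
    change Ared.b₂ = _
    rw [hAred, map_b₂, eq_intCast]
  have htr : A.frobeniusTrace 3 = ((3 : ℕ) : ℤ) + 1 - ((Nat.card Ared.toAffine.Point : ℕ) : ℤ) := rfl
  have e1 := ZMod.intCast_zmod_eq_zero_iff_dvd (A.frobeniusTrace 3) 3
  have e2 := ZMod.intCast_zmod_eq_zero_iff_dvd I.b₂ 3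
  rw [Nat.cast_ofNat] at e1 e2
  rw [← e1, ← e2, htr, key, hb]

/-- The `c₄/c₆` criterion read on the integral model: `A.c₄ = I.c₄`, `A.c₆ = I.c₆` in `ℚ` and
`v₃` of an integer is `padicValInt`. [folklore] -/
theorem locIrrCriterionThree_iff_integralModelInt :
    LocIrrCriterionThree A ↔
      (integralModelInt A).c₄ ≠ 0 ∧ ((integralModelInt A).c₆ = 0 ∨
        3 * padicValInt 3 (integralModelInt A).c₄ + 2 ≤ 2 * padicValInt 3 (integralModelInt A).c₆) := by
  set I := integralModelInt A with hI
  have hc4 : A.c₄ = (I.c₄ : ℚ) := by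
    have h := congrArg WeierstrassCurve.c₄ (map_integralModelInt A)
    rw [map_c₄, eq_intCast] at h
    exact h.symm
  have hc6 : A.c₆ = (I.c₆ : ℚ) := by
    have h := congrArg WeierstrassCurve.c₆ (map_integralModelInt A)
    rw [map_c₆, eq_intCast] at h
    exact h.symm
  unfold LocIrrCriterionThree
  rw [hc4, hc6, padicValRat.of_int, padicValRat.of_int, Int.cast_ne_zero, Int.cast_eq_zero]
  constructor
  · rintro ⟨h4, h⟩
    refine ⟨h4, h.imp id fun hle ↦ ?_⟩
    exact_mod_cast hle
  · rintro ⟨h4, h⟩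
    refine ⟨h4, h.imp id fun hle ↦ ?_⟩
    exact_mod_cast hle

/-- **At a prime of GOOD reduction `3`: `E[3]|G_{ℚ₃}` is irreducible iff `3 ∣ a₃(E)`** — good
supersingular ⟺ locally irreducible, good ordinary ⟺ locally reducible (Serre 1972 §1.11 Prop.
11–12), here for every globally minimal elliptic `A / ℚ` via L-O56-sel (`locIrrThreeIffCriterion_holds`),
`a₃ ≡ b₂ (mod 3)` and the integer lemma. [cite: Serre1972, §1.11 Prop. 12] -/
theorem locIrr_three_iff_dvd_frobeniusTrace_of_hasGoodReductionAtPrime [A.IsElliptic]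
    (hgood : A.HasGoodReductionAtPrime 3) : LocIrr A 3 ↔ (3 : ℤ) ∣ A.frobeniusTrace 3 := by
  have hΔ : ¬ (3 : ℤ) ∣ A.minimalDiscriminantInt :=
    A.not_dvd_minimalDiscriminantInt_of_hasGoodReductionAtPrime 3 hgood
  rw [locIrrThreeIffCriterion_holds A, three_dvd_frobeniusTrace_iff_three_dvd_b₂ A hΔ,
    locIrrCriterionThree_iff_integralModelInt A]
  exact (three_dvd_b₂_iff_criterion (integralModelInt A) hΔ).symm

/-- **Good SUPERSINGULAR at `3` ⟹ `E[3]|G_{ℚ₃}` irreducible** (`3 ∣ a₃`; at `p = 3` this is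
`a₃ ∈ {0, ±3}`, all supersingular — Serre 1972 §1.11 Prop. 12). [cite: Serre1972, §1.11 Prop. 12] -/
theorem locIrr_three_of_dvd_frobeniusTrace [A.IsElliptic] (hgood : A.HasGoodReductionAtPrime 3)
    (hss : (3 : ℤ) ∣ A.frobeniusTrace 3) : LocIrr A 3 :=
  (locIrr_three_iff_dvd_frobeniusTrace_of_hasGoodReductionAtPrime A hgood).mpr hss

/-- **Good ORDINARY at `3` ⟹ `E[3]|G_{ℚ₃}` reducible** (`3 ∤ a₃`: the canonical line — Serre 1972
§1.11 Prop. 11). [cite: Serre1972, §1.11 Prop. 11] -/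
theorem not_locIrr_three_of_not_dvd_frobeniusTrace [A.IsElliptic]
    (hgood : A.HasGoodReductionAtPrime 3) (hord : ¬ (3 : ℤ) ∣ A.frobeniusTrace 3) : ¬ LocIrr A 3 :=
  fun h ↦ hord ((locIrr_three_iff_dvd_frobeniusTrace_of_hasGoodReductionAtPrime A hgood).mp h)

end GoodThree

/-! ## §5 The node -/

/-- **T-O6-D′ (iii) `CompanionTypeIffLocIrrThree` PROVED**: for every companion pair `(W, A)` at `3`
(`A` good at `3`, `A[3] ≅ W[3]` as `Gal(ℚ̄/ℚ)`-modules), `W[3]|G_{ℚ₃}` is irreducible iff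
`3 ∣ a₃(A)`. (S1) `LocIrr W 3 ↔ LocIrr A 3` by transport; (S2) `LocIrr A 3 ↔ 3 ∣ a₃(A)` at the good
prime `3`. The census 1 639 + 8 | 168 / 0 stays EVIDENCE; nothing booked; O6 OPEN.
[cite: Serre1972, §1.11 Prop. 12] -/
theorem companionTypeIffLocIrrThree_holds : CompanionTypeIffLocIrrThree := by
  intro W A _ _ _ _ hcomp
  rw [locIrr_three_iff_of_isCompanionThree W A hcomp]
  exact locIrr_three_iff_dvd_frobeniusTrace_of_hasGoodReductionAtPrime A hcomp.1

end Summit.BirchSwinnertonDyer.Rank1Residual.Additive
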